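import Literature.MathematicalPhysics.QuantumLattice.HeisenbergOrderNeelTwoSumRule
import Literature.MathematicalPhysics.QuantumLattice.HubbardLangerMattisFourByFour
import Summits.HubbardSuperconductivity.HubbardLadder.Targets
import HarnessLib

/-!
# R2 rows (device D4d): certified lower bounds on `m_s²(L)` for the spin-½ Heisenberg antiferromagnet on the `4×4` and `6×6` tori from the Kennedy–Lieb–Shastry two-sum-rule bound

HONEST FRAMING: ladder R1–R4 with certified numbers; no claim on H/H₀. Cell pub-hubbard, seat r2
(gen 4). Each theorem is a statement about ONE finite matrix; none bears on H₀ (no uniformity in `L`).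

The Literature theorem `kls_heis_twoSumRule` (KLS 1988, eqs. (2), (3), (6)–(9) in finite volume)
gives, for every real `t`, `m² = |Λ|⁻¹ĝ_Q ≥ (1-t)/4 + t u - (u/2)^{1/2} 𝓦_t(L)` with `u = -E₀/(6L²)`.
Here the punctured Riemann sums `𝓦_t(4)`, `𝓦_t(6)` are evaluated in closed form (the torus cosines
are `0, ±1` resp. `±1, ±½`) and bounded by rationals, giving kernel-checked rows of R2-TABLE §A8:

* `neelOrderParamSq_four_ge`  : `0.1637 ≤ m_s²(4)`  (no energy input; `t = 7/12`);
* `neelOrderParamSq_six_ge`   : `0.0786 ≤ m_s²(6)`  (no energy input; `t = 2/3`);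
* `neelOrderParamSq_four_ge_of_groundEnergy_le` : `E₀(4×4) ≤ -11.2284831934 → 0.1938 ≤ m_s²(4)` (`t = 1`;
  the hypothesis is pub-mbboot's certified ED enclosure [H_4x4], cited, not re-proved);
* `neelOrderParamSq_six_ge_of_groundEnergy_le`  : `E₀(6×6) ≤ -24.0846218 → 0.0892 ≤ m_s²(6)` (`t = 4/5`;
  hypothesis = pub-mbboot [H_6], integer-MPS `D = 128` Rayleigh quotient `-26481321726599/2⁴⁰`).

Script certificates with more digits (0.163765 / 0.078726 / 0.193816 / 0.089228, and the `8×8`,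
`10×10` rows 0.035507 / 0.004376 whose cosines are irrational) live in
`pub-hubbard-r2/irrows/IR-ROWS.md`; comparators (numerics, never inputs): `m_s²(4) = 0.2765271` (ED),
`m_s²(6) = 0.2098368(2)` (Sandvik 2026).
-/

noncomputable section

open Finset Literature.MathematicalPhysics.QuantumLattice Literature.Probability.LatticeModels

namespace Summit.HubbardSuperconductivity.HubbardLadder

/-! ### The summand of `𝓦_t(L)` for `d = 2` as a function of the two cosines -/

/-- `T_t(c₁,c₂) = {(1-t) - t(c₁+c₂)/2}₊ ((2-c₁-c₂)/(2+c₁+c₂))^{1/2}` (junk `0` when `c₁+c₂ = -2`). -/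
def twoSumTerm (t c₁ c₂ : ℝ) : ℝ :=
  max ((1 - t) - t * ((c₁ + c₂) / 2)) 0 * Real.sqrt ((2 - (c₁ + c₂)) / (2 + (c₁ + c₂)))

/-- The summand of the punctured KLS two-sum Riemann sum at momentum `q` is `twoSumTerm` of the two cosines. [cite: KLS1988JSP, eqs. (6)-(9)] -/
theorem twoSumTerm_summand (k : ℕ) [NeZero (2 * k)] (t : ℝ) (q : TorusSite 2 (2 * k)) :
    max (klsTwoSumKernel t (2 * k) q) 0 *
        Real.sqrt (dispersion (latticeMomentum (2 * k) q) /
          dispersion (latticeMomentum (2 * k) (q - neelIndex (2 * k)))) =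
      twoSumTerm t (Real.cos (latticeMomentum (2 * k) q 0))
        (Real.cos (latticeMomentum (2 * k) q 1)) := by
  rw [dispersion_latticeMomentum_sub_neelIndex k q, dispersion_latticeMomentum_eq, klsTwoSumKernel,
    twoSumTerm, torusCosSum, Fin.sum_univ_two]
  push_cast
  ring_nf

/-- `𝓦_t(2k) = (2k)⁻² Σ_{q} T_t(cos q₁, cos q₂)` over the WHOLE dual torus (the `q = Q` term is the
junk value `0`). -/
theorem klsTwoSumRiemannSum_eq_sum_twoSumTerm (k : ℕ) [NeZero (2 * k)] (t : ℝ) :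
    klsTwoSumRiemannSum (d := 2) t (2 * k) =
      (∑ q : TorusSite 2 (2 * k), twoSumTerm t (Real.cos (latticeMomentum (2 * k) q 0))
          (Real.cos (latticeMomentum (2 * k) q 1))) / ((2 * k : ℕ) : ℝ) ^ 2 := by
  rw [klsTwoSumRiemannSum_of_neZero, sum_congr rfl fun q _ => twoSumTerm_summand k t q]
  congr 1
  apply Finset.sum_erase
  rw [latticeMomentum_neelIndex k 0, latticeMomentum_neelIndex k 1, Real.cos_pi, twoSumTerm]
  norm_num

/-! ### `L = 4`: cosines `1, 0, -1, 0` -/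

/-- The `4 × 4` momentum sum of `twoSumTerm` written out over the cosines `1, 0, -1, 0`. [cite: KLS1988JSP, eqs. (6)-(9)] -/
theorem sum_twoSumTerm_four (t : ℝ) :
    ∑ q : TorusSite 2 4, twoSumTerm t (Real.cos (latticeMomentum 4 q 0))
        (Real.cos (latticeMomentum 4 q 1)) =
      ∑ ab : Fin 4 × Fin 4, twoSumTerm t (LangerMattis.cosFour ab.1.val) (LangerMattis.cosFour ab.2.val) := by
  refine Fintype.sum_equiv (piFinTwoEquiv fun _ => ZMod 4) _ _ fun k => ?_
  rw [LangerMattis.cos_latticeMomentum_four, LangerMattis.cos_latticeMomentum_four]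
  rfl

/-- Closed form of the punctured two-sum Riemann sum `W_t(4)` on the `4 × 4` torus. [cite: KLS1988JSP, eqs. (6)-(9)] -/
theorem klsTwoSumRiemannSum_four (t : ℝ) :
    klsTwoSumRiemannSum (d := 2) t 4 =
      (4 * twoSumTerm t 1 0 + 4 * twoSumTerm t 0 (-1) + 4 * twoSumTerm t 0 0 +
          2 * twoSumTerm t 1 (-1) + twoSumTerm t 1 1 + twoSumTerm t (-1) (-1)) / 16 := by
  haveI : NeZero (2 * 2) := ⟨by norm_num⟩
  have h := klsTwoSumRiemannSum_eq_sum_twoSumTerm 2 t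
  have hv : (0 : Fin 4).val = 0 ∧ (1 : Fin 4).val = 1 ∧ (2 : Fin 4).val = 2 ∧ (3 : Fin 4).val = 3 :=
    ⟨rfl, rfl, rfl, rfl⟩
  have hc : LangerMattis.cosFour 0 = 1 ∧ LangerMattis.cosFour 1 = 0 ∧ LangerMattis.cosFour 2 = -1 ∧
      LangerMattis.cosFour 3 = 0 := ⟨rfl, rfl, rfl, rfl⟩
  have hs : twoSumTerm t 0 1 = twoSumTerm t 1 0 ∧ twoSumTerm t (-1) 0 = twoSumTerm t 0 (-1) ∧
      twoSumTerm t (-1) 1 = twoSumTerm t 1 (-1) := by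
    refine ⟨?_, ?_, ?_⟩ <;> simp only [twoSumTerm] <;> ring_nf
  have h4 : klsTwoSumRiemannSum (d := 2) t 4 = klsTwoSumRiemannSum (d := 2) t (2 * 2) := rfl
  rw [h4, h, sum_twoSumTerm_four, Fintype.sum_prod_type]
  simp only [Fin.sum_univ_four, hv.1, hv.2.1, hv.2.2.1, hv.2.2.2, hc.1, hc.2.1, hc.2.2.1, hc.2.2.2,
    hs.1, hs.2.1, hs.2.2]
  norm_num
  ring


/-- `√x ≤ c` from `x ≤ c²`, `c ≥ 0` (numeric helper). -/
private theorem sqrt_le_of_le_sq {x c : ℝ} (hc : 0 ≤ c) (h : x ≤ c ^ 2) : Real.sqrt x ≤ c := by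
  rw [← Real.sqrt_sq hc]; exact Real.sqrt_le_sqrt h

/-- `√3 ≤ 1.7320509`. -/
private theorem sqrt_three_le : Real.sqrt 3 ≤ 1.7320509 := sqrt_le_of_le_sq (by norm_num) (by norm_num)
/-- `(1/3)^{1/2}` in the form `norm_num` leaves it. -/
private theorem inv_sqrt_three_le : (Real.sqrt 3)⁻¹ ≤ 0.5773503 := by
  rw [← Real.sqrt_inv]; exact sqrt_le_of_le_sq (by norm_num) (by norm_num)
/-- `(3/5)^{1/2}` in the form `norm_num` leaves it. -/
private theorem sqrt_three_div_sqrt_five_le : Real.sqrt 3 / Real.sqrt 5 ≤ 0.7745967 := by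
  rw [← Real.sqrt_div (by norm_num : (0 : ℝ) ≤ 3)]; exact sqrt_le_of_le_sq (by norm_num) (by norm_num)
/-- `(5/3)^{1/2}` in the form `norm_num` leaves it. -/
private theorem sqrt_five_div_sqrt_three_le : Real.sqrt 5 / Real.sqrt 3 ≤ 1.2909945 := by
  rw [← Real.sqrt_div (by norm_num : (0 : ℝ) ≤ 5)]; exact sqrt_le_of_le_sq (by norm_num) (by norm_num)
/-- `√7 ≤ 2.6457514`. -/
private theorem sqrt_seven_le : Real.sqrt 7 ≤ 2.6457514 := sqrt_le_of_le_sq (by norm_num) (by norm_num)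

/-- `𝓦_{7/12}(4) = ((1/2)(1/3)^{1/2} + (17/6)√3 + 5/2)/16 ≤ 0.48101`. -/
theorem klsTwoSumRiemannSum_four_le_a : klsTwoSumRiemannSum (d := 2) (7 / 12 : ℝ) 4 ≤ 0.48101 := by
  rw [klsTwoSumRiemannSum_four]
  have h3 := sqrt_three_le
  have h13 := inv_sqrt_three_le
  norm_num [twoSumTerm, max_def]
  linarith [h3, h13]

/-- `𝓦_1(4) = √3/8 ≤ 0.2165064`. -/
theorem klsTwoSumRiemannSum_four_le_b : klsTwoSumRiemannSum (d := 2) (1 : ℝ) 4 ≤ 0.2165064 := by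
  rw [klsTwoSumRiemannSum_four]
  have h3 := sqrt_three_le
  norm_num [twoSumTerm, max_def]
  linarith [h3]

/-- R2 row (A8, `4×4`, energy-free): `m_s²(4) ≥ 0.1637` for every `J > 0` (script value 0.163765). -/
theorem neelOrderParamSq_four_ge (J : ℝ) (hJ : 0 < J) : (0.1637 : ℝ) ≤ neelOrderParamSq 4 J := by
  haveI : NeZero (2 * 2) := ⟨by norm_num⟩
  have h := kls_heis_neelSum_ge_energyFree (d := 2) (by norm_num) 1 2 le_rfl hJ
    (t := 7 / 12) (by norm_num)
  have hW0 : 0 ≤ klsTwoSumRiemannSum (d := 2) (7 / 12 : ℝ) (2 * 2) := klsTwoSumRiemannSum_nonneg _ _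
  have hW : klsTwoSumRiemannSum (d := 2) (7 / 12 : ℝ) (2 * 2) ≤ 0.48101 := klsTwoSumRiemannSum_four_le_a
  have hW2 := mul_le_mul hW hW hW0 (by norm_num)
  have e4 : neelOrderParamSq 4 J = (∑ x : TorusSite 2 (2 * 2), ∑ y : TorusSite 2 (2 * 2),
      (-1 : ℝ) ^ (∑ i, (x i).val) * (-1) ^ (∑ i, (y i).val) *
        groundStateSpinCorrTorus (d := 2) (2 * 2) 1 J x y) / ((2 * 2 : ℕ) : ℝ) ^ (2 * 2) :=
    rfl
  rw [e4]
  refine le_trans ?_ h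
  norm_num
  nlinarith [hW2, hW0, hW]

/-- R2 row (A8, `4×4`, bracket): with pub-mbboot's certified enclosure `E₀(4×4) ≤ -11.2284831934`
[H_4x4] as HYPOTHESIS, `m_s²(4) ≥ 0.1938` (script value 0.193816; ED comparator 0.2765271). -/
theorem neelOrderParamSq_four_ge_of_groundEnergy_le (J : ℝ) (hJ : 0 < J)
    (hE : (heisenbergTorus 2 4 1 1).groundEnergy ≤ -11.2284831934) :
    (0.1938 : ℝ) ≤ neelOrderParamSq 4 J := by
  haveI : NeZero (2 * 2) := ⟨by norm_num⟩
  have hW0 : 0 ≤ klsTwoSumRiemannSum (d := 2) (1 : ℝ) (2 * 2) := klsTwoSumRiemannSum_nonneg _ _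
  have hW : klsTwoSumRiemannSum (d := 2) (1 : ℝ) (2 * 2) ≤ 0.2165064 := klsTwoSumRiemannSum_four_le_b
  have hW2 := mul_le_mul hW hW hW0 (by norm_num)
  have h := kls_heis_twoSumRule_of_groundEnergy_le (d := 2) (by norm_num) 1 2 le_rfl (t := 1)
    (Eup := -11.2284831934) zero_le_one hE (by norm_num) (by norm_num at hW2 ⊢; nlinarith [hW2])
  have hs : Real.sqrt (-(-11.2284831934 : ℝ) / (3 * ((2 : ℕ) : ℝ) * ((2 * 2 : ℕ) : ℝ) ^ 2) / 2) ≤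
      0.2418299 := sqrt_le_of_le_sq (by norm_num) (by norm_num)
  have hs0 := Real.sqrt_nonneg (-(-11.2284831934 : ℝ) / (3 * ((2 : ℕ) : ℝ) * ((2 * 2 : ℕ) : ℝ) ^ 2) / 2)
  have e4 : neelOrderParamSq 4 J = (∑ x : TorusSite 2 (2 * 2), ∑ y : TorusSite 2 (2 * 2),
      (-1 : ℝ) ^ (∑ i, (x i).val) * (-1) ^ (∑ i, (y i).val) *
        groundStateSpinCorrTorus (d := 2) (2 * 2) 1 J x y) / ((2 * 2 : ℕ) : ℝ) ^ (2 * 2) :=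
    rfl
  rw [e4, neelSum_eq 1 2 hJ]
  have hprod := mul_le_mul hs hW hW0 (by norm_num)
  norm_num at h hprod ⊢
  nlinarith [h, hprod]

/-! ### `L = 6`: cosines `1, ½, -½, -1, -½, ½` -/

/-- `cos (2πj/6)`, `j = 0,…,5`. -/
def cosSix : ℕ → ℝ
  | 0 => 1
  | 1 => 1 / 2
  | 2 => -1 / 2
  | 3 => -1
  | 4 => -1 / 2
  | 5 => 1 / 2
  | _ => 0

/-- The cosines of the `6 × 6` lattice momenta are the values of `cosSix`. [folklore] -/
theorem cos_latticeMomentum_six (k : TorusSite 2 6) (i : Fin 2) :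
    Real.cos (latticeMomentum 6 k i) = cosSix (k i).val := by
  unfold latticeMomentum
  have hv : (k i).val < 6 := ZMod.val_lt (k i)
  generalize (k i).val = v at hv ⊢
  interval_cases v
  · norm_num [cosSix]
  · have h : 2 * Real.pi * ((1 : ℕ) : ℝ) / ((6 : ℕ) : ℝ) = Real.pi / 3 := by push_cast; ring
    rw [h, Real.cos_pi_div_three]; norm_num [cosSix]
  · have h : 2 * Real.pi * ((2 : ℕ) : ℝ) / ((6 : ℕ) : ℝ) = Real.pi - Real.pi / 3 := by push_cast; ring
    rw [h, Real.cos_pi_sub, Real.cos_pi_div_three]; norm_num [cosSix]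
  · have h : 2 * Real.pi * ((3 : ℕ) : ℝ) / ((6 : ℕ) : ℝ) = Real.pi := by push_cast; ring
    rw [h, Real.cos_pi]; norm_num [cosSix]
  · have h : 2 * Real.pi * ((4 : ℕ) : ℝ) / ((6 : ℕ) : ℝ) = Real.pi / 3 + Real.pi := by push_cast; ring
    rw [h, Real.cos_add_pi, Real.cos_pi_div_three]; norm_num [cosSix]
  · have h : 2 * Real.pi * ((5 : ℕ) : ℝ) / ((6 : ℕ) : ℝ) = 2 * Real.pi - Real.pi / 3 := by
      push_cast; ring
    rw [h, Real.cos_two_pi_sub, Real.cos_pi_div_three]; norm_num [cosSix]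

/-- The `6 × 6` momentum sum of `twoSumTerm` written out over `cosSix`. [cite: KLS1988JSP, eqs. (6)-(9)] -/
theorem sum_twoSumTerm_six (t : ℝ) :
    ∑ q : TorusSite 2 6, twoSumTerm t (Real.cos (latticeMomentum 6 q 0))
        (Real.cos (latticeMomentum 6 q 1)) =
      ∑ ab : Fin 6 × Fin 6, twoSumTerm t (cosSix ab.1.val) (cosSix ab.2.val) := by
  refine Fintype.sum_equiv (piFinTwoEquiv fun _ => ZMod 6) _ _ fun k => ?_
  rw [cos_latticeMomentum_six, cos_latticeMomentum_six]
  rfl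

/-- Closed form of the punctured two-sum Riemann sum `W_t(6)` on the `6 × 6` torus. [cite: KLS1988JSP, eqs. (6)-(9)] -/
theorem klsTwoSumRiemannSum_six (t : ℝ) :
    klsTwoSumRiemannSum (d := 2) t 6 =
      (∑ ab : Fin 6 × Fin 6, twoSumTerm t (cosSix ab.1.val) (cosSix ab.2.val)) / 36 := by
  haveI : NeZero (2 * 3) := ⟨by norm_num⟩
  have h6 : klsTwoSumRiemannSum (d := 2) t 6 = klsTwoSumRiemannSum (d := 2) t (2 * 3) := rfl
  rw [h6, klsTwoSumRiemannSum_eq_sum_twoSumTerm 3 t, sum_twoSumTerm_six]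
  norm_num

/-- Values of the numerals of `Fin 6` (numeric helper). -/
private theorem fin6_val : (0 : Fin 6).val = 0 ∧ (1 : Fin 6).val = 1 ∧ (2 : Fin 6).val = 2 ∧
    (3 : Fin 6).val = 3 ∧ (4 : Fin 6).val = 4 ∧ (5 : Fin 6).val = 5 := ⟨rfl, rfl, rfl, rfl, rfl, rfl⟩
/-- The table of `cosSix` (numeric helper). -/
private theorem cosSix_val : cosSix 0 = 1 ∧ cosSix 1 = 1 / 2 ∧ cosSix 2 = -1 / 2 ∧ cosSix 3 = -1 ∧
    cosSix 4 = -1 / 2 ∧ cosSix 5 = 1 / 2 := ⟨rfl, rfl, rfl, rfl, rfl, rfl⟩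

/-- `𝓦_{2/3}(6) = ((2/3)(3/5)^{1/2} + 10/3 + 2(5/3)^{1/2} + (8/3)√3 + (10/3)√7)/36 ≤ 0.551937`. -/
theorem klsTwoSumRiemannSum_six_le_a : klsTwoSumRiemannSum (d := 2) (2 / 3 : ℝ) 6 ≤ 0.551937 := by
  rw [klsTwoSumRiemannSum_six, Fintype.sum_prod_type]
  simp only [Fin.sum_univ_six, fin6_val, cosSix_val]
  have h3 := sqrt_three_le
  have h35 := sqrt_three_div_sqrt_five_le
  have h53 := sqrt_five_div_sqrt_three_le
  have h7 := sqrt_seven_le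
  norm_num [twoSumTerm, max_def]
  linarith [h3, h35, h53, h7]

/-- `𝓦_{4/5}(6) = (2 + (8/5)(5/3)^{1/2} + (12/5)√3 + (16/5)√7)/36 ≤ 0.4635812`. -/
theorem klsTwoSumRiemannSum_six_le_b : klsTwoSumRiemannSum (d := 2) (4 / 5 : ℝ) 6 ≤ 0.4635812 := by
  rw [klsTwoSumRiemannSum_six, Fintype.sum_prod_type]
  simp only [Fin.sum_univ_six, fin6_val, cosSix_val]
  have h3 := sqrt_three_le
  have h53 := sqrt_five_div_sqrt_three_le
  have h7 := sqrt_seven_le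
  norm_num [twoSumTerm, max_def]
  linarith [h3, h53, h7]

/-- R2 row (A8, `6×6`, energy-free): `m_s²(6) ≥ 0.0786` for every `J > 0` (script value 0.078726). -/
theorem neelOrderParamSq_six_ge (J : ℝ) (hJ : 0 < J) : (0.0786 : ℝ) ≤ neelOrderParamSq 6 J := by
  haveI : NeZero (2 * 3) := ⟨by norm_num⟩
  have h := kls_heis_neelSum_ge_energyFree (d := 2) (by norm_num) 1 3 (by norm_num) hJ
    (t := 2 / 3) (by norm_num)
  have hW0 : 0 ≤ klsTwoSumRiemannSum (d := 2) (2 / 3 : ℝ) (2 * 3) := klsTwoSumRiemannSum_nonneg _ _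
  have hW : klsTwoSumRiemannSum (d := 2) (2 / 3 : ℝ) (2 * 3) ≤ 0.551937 := klsTwoSumRiemannSum_six_le_a
  have hW2 := mul_le_mul hW hW hW0 (by norm_num)
  have e6 : neelOrderParamSq 6 J = (∑ x : TorusSite 2 (2 * 3), ∑ y : TorusSite 2 (2 * 3),
      (-1 : ℝ) ^ (∑ i, (x i).val) * (-1) ^ (∑ i, (y i).val) *
        groundStateSpinCorrTorus (d := 2) (2 * 3) 1 J x y) / ((2 * 3 : ℕ) : ℝ) ^ (2 * 2) :=
    rfl
  rw [e6]
  refine le_trans ?_ h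
  norm_num
  nlinarith [hW2, hW0, hW]

/-- R2 row (A8, `6×6`, bracket): with pub-mbboot's certified integer-MPS (`D = 128`) Rayleigh quotient
`E₀(6×6) ≤ -26481321726599/2⁴⁰ ≤ -24.0846218` [H_6] as HYPOTHESIS, `m_s²(6) ≥ 0.0892` (script value
0.089228; QMC comparator 0.2098368(2), Sandvik 2026). -/
theorem neelOrderParamSq_six_ge_of_groundEnergy_le (J : ℝ) (hJ : 0 < J)
    (hE : (heisenbergTorus 2 6 1 1).groundEnergy ≤ -24.0846218) :
    (0.0892 : ℝ) ≤ neelOrderParamSq 6 J := by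
  haveI : NeZero (2 * 3) := ⟨by norm_num⟩
  have hW0 : 0 ≤ klsTwoSumRiemannSum (d := 2) (4 / 5 : ℝ) (2 * 3) := klsTwoSumRiemannSum_nonneg _ _
  have hW : klsTwoSumRiemannSum (d := 2) (4 / 5 : ℝ) (2 * 3) ≤ 0.4635812 :=
    klsTwoSumRiemannSum_six_le_b
  have hW2 := mul_le_mul hW hW hW0 (by norm_num)
  have h := kls_heis_twoSumRule_of_groundEnergy_le (d := 2) (by norm_num) 1 3 (by norm_num) (t := 4 / 5)
    (Eup := -24.0846218) (by norm_num) hE (by norm_num) (by norm_num at hW2 ⊢; nlinarith [hW2])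
  have hs : Real.sqrt (-(-24.0846218 : ℝ) / (3 * ((2 : ℕ) : ℝ) * ((2 * 3 : ℕ) : ℝ) ^ 2) / 2) ≤
      0.2361175 := sqrt_le_of_le_sq (by norm_num) (by norm_num)
  have hs0 := Real.sqrt_nonneg (-(-24.0846218 : ℝ) / (3 * ((2 : ℕ) : ℝ) * ((2 * 3 : ℕ) : ℝ) ^ 2) / 2)
  have e6 : neelOrderParamSq 6 J = (∑ x : TorusSite 2 (2 * 3), ∑ y : TorusSite 2 (2 * 3),
      (-1 : ℝ) ^ (∑ i, (x i).val) * (-1) ^ (∑ i, (y i).val) *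
        groundStateSpinCorrTorus (d := 2) (2 * 3) 1 J x y) / ((2 * 3 : ℕ) : ℝ) ^ (2 * 2) :=
    rfl
  rw [e6, neelSum_eq 1 3 hJ]
  have hprod := mul_le_mul hs hW hW0 (by norm_num)
  norm_num at h hprod ⊢
  nlinarith [h, hprod]

end Summit.HubbardSuperconductivity.HubbardLadder
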